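import Summits.BirchSwinnertonDyer.Rank1Residual.Partition.CornersSchneider
import Literature.NumberTheory.EllipticCurves.Rank1Residual.X9MuInvariant
import HarnessLib

/-!
# The good ORDINARY axis at `p ≥ 5`: modulo the pair's Schneider certificate AND Greenberg's
# `μ = 0` at the X9 pairs, the corner is the Keller–Yin locus `X1 ∧ ¬gvpar` ALONE
# (cell `b2b-bsdres`, RESIDUAL-MAP.md §A row 'irreducible, not surjective' × {5, 7} = §I N3;
# CLASS-CLOSURE-PLAN.md §3.16 'irreducible residue' of N3 in kernel form; rmap-1 gen 8)

HONEST FRAMING (run/shared/lean/b2b/bsd-rank1-residual/, verbatim in every file): the goal of the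
cell is to DELETE the COMBINATION-SHAPED residual classes of the Birch–Swinnerton-Dyer formula for
ALL analytic-rank `≤ 1` elliptic curves over `ℚ` — "full BSD formula for every rank `≤ 1` curve in
class `C`" assembled STRICTLY from published theorems — so that the rank-`≤ 1` remainder becomes
exactly the CONSTRUCTION-SHAPED classes, which are TYPED (missing-input `Prop`s), NOT attempted.
This is not "finishing BSD". Theorems only; NO definition, NO named fact introduced here; every
published theorem enters as one of the tree's existing named Literature facts BY NAME; nothing
about any particular curve is asserted; no label changes; nothing is booked by this file.

## What this file records

`Partition/CornersSchneider.lean` (rmap-1 gen 7): for non-CM `E/ℚ` of analytic rank `r ≤ 1` and a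
good ORDINARY prime `p ≥ 5` carrying the pair's Schneider certificate, `BSD(E,p)` holds outside
`(ClassX1 ∧ ¬GVPar) ∨ ClassX9` (nine named facts). The X9 prover's Literature theorem
`X9.bsdp_of_mu_eq_zero_of_analyticRank_le_one` (`Rank1Residual/X9MuInvariant.lean`, x9 gen 5) closes
an X9 pair (`p ∈ {5, 7}`, image `5Ns / 5S4 / 7Ns`) from PUBLISHED named facts — Burungale–Castella–
Skinner 2025 Thm. 1.1.2 **(a)** (the RATIONAL cyclotomic main conjecture under (irr_ℚ) alone, no
image hypothesis), Greenberg LNM 1716 Thm. 4.1, the period unit, modularity, GZK, and in rank one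
Perrin-Riou–Schneider + Perrin-Riou 1987 — GRANTED, at the pair, (i) Greenberg's conjecture
`μ(X(E/ℚ_∞)) = 0` (LNM 1716 §1 Conj. 1.11: "if `E[p]` is irreducible … then `μ_E = 0`"; OPEN, in
print as a conjecture; on X9 in rank `0` it is EQUIVALENT to `BSD(E,p)`, `X9.bsdp_iff_mu_eq_zero`),
(ii) one finite analytic certificate (a unit coefficient of the Néron-normalised `𝓛_p(E)`, i.e.
`μ^an = 0`), and (iii) in rank one the same Schneider certificate.

Composing the two gives the §A corner at `p ≥ 5` in its EIGHTH closing form, the one the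
CLASS-CLOSURE lane asked for ('the irreducible residue named precisely'): **modulo two
conjectures-in-print applied AT THE PAIR — Schneider 1985 (non-degeneracy of the cyclotomic `p`-adic
height) and Greenberg 1999 Conj. 1.11 at the X9 pairs — plus one finite certificate, the only corner
of the good ordinary axis at `p ≥ 5` is the Keller–Yin locus `ClassX1 ∧ ¬GVPar`** (Eisenstein,
anomalous, type A; Keller–Yin arXiv:2402.12781 Thm. 3 announced, PRE):

* `bsdp_of_classX9_of_greenbergMu_of_schneider` — the X9 exit: a one-line wrapper of the x9 seat's
  `X9.bsdp_of_mu_eq_zero_of_analyticRank_le_one` with the Schneider certificate in the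
  `CornersSchneider` binder shape;
* `bsdp_goodOrd_of_five_le_of_schneider_of_greenbergMu` — **non-CM, `r ≤ 1`, good ordinary
  `p ≥ 5`, the pair's Schneider certificate, and ON X9 Greenberg's `μ = 0` + the unit-coefficient
  certificate: `BSD(E,p)` unless `ClassX1 W p ∧ ¬ GVPar W p`** — ELEVEN named facts (the nine of
  `bsdp_goodOrd_of_five_le_of_schneider_sharp` + BCS Thm. 1.1.2 (a) `hBCSa` + the period unit
  `hΩ`); partition form `bsdp_or_typeA_of_five_le_of_schneider_of_greenbergMu`;
* `greenbergMu_of_bsdp_of_classX9_rankZero` — the hypothesis is NECESSARY on X9 in rank `0`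
  (re-export of `X9.mu_eq_zero_of_bsdp`): the reduction to the Keller–Yin locus is TIGHT there;
* `bsdp_goodOrd_of_five_le_allCurves_of_schneider_of_greenbergMu` — every `E/ℚ` (+ `hCM`, `hKob`
  on the CM branch, where no corner is met at a good odd prime);
* `bsdp_goodOrd_or_mult_of_five_le_of_schneider_of_greenbergMu` — the coordinator's domain at
  `p ≥ 5` ('good ordinary, or multiplicative with `r = 0`'; + Skinner 2016 Thm. C `hSk`): corners
  `(X1 ∧ ¬gvpar) ∨ X11a ∨ X2`.

The binders `hSch`, `hμ`, `hcert` are PER PAIR (hypotheses on `(W, p)`); `hμ` and `hcert` are asked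
only on `ClassX9 W p`. `hμ` is an OPEN conjecture instance, not a certificate: per pair the x9
lineage DISCHARGES it by other routes (CM partner U1′ `X9CMPartner`, trivial / `BSD_p` partner U2 /
U2′ `X9TrivialPartner` / `X9MuInvariant` via Greenberg–Vatsal 2000 Thm. (1.4); exact Shapiro
`5`- and `7`-descent `X9/ShapiroPairs*`; Cha + descent + Cassels–Tate `X9/ChaDescentRoute`, where `μ = 0`
becomes a CONSEQUENCE) — 789 of the 790 X9 pairs below `5·10⁵` (x9 gen 13 fold). No mark of
RESIDUAL-MAP moves: N3 stays NEEDS X_A5 (§I), N1 the Keller–Yin seam. Flags that ride: as in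
`CornersSchneider` (`BCS25-IMC-equiv@BSTW` with `hBCS` — NOT with `hBCSa`, which is part (a), proved
in BCS without Thm. 4.1.3; `CGS25-BST-Thm311` with `hCGS`; `GV-chain` with `hGV`/`hGr`).

References: RESIDUAL-MAP.md §A (row 'irreducible, not surjective'; RMAP NOTE (rmap-1 g8) N3
CLASS-CLOSURE RECORD), §I N1 / N3; `Partition/CornersSchneider.lean`;
`Literature/…/Rank1Residual/X9MuInvariant.lean` (x9 GEN 5); [GreenbergLNM1716] §1 Conj. 1.11,
Thm. 4.1; [BurungaleCastellaSkinner2025] Thm. 1.1.2 (a), Cor. 1.3.1; [Schneider1985];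
[PerrinRiou1987] §1.4; [KellerYin2024] Thm. 3; [Miller2011LMS] Def. 1.1.
-/

namespace Summit.BirchSwinnertonDyer.Rank1Residual

open WeierstrassCurve Literature.NumberTheory.EllipticCurves
  Literature.NumberTheory.EllipticCurves.Rank1Residual Literature.NumberTheory.EllipticCurves.ModularForms
  Literature.NumberTheory.EllipticCurves.Wuthrich2014
  Literature.NumberTheory.EllipticCurves.Rank1Residual.Typed
open scoped NumberField ModularForm

section Curve

variable {W : WeierstrassCurve ℚ} [W.IsElliptic] [W.IsGloballyMinimal] {p : ℕ} [Fact p.Prime]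

/-! ### The X9 exit: Greenberg's `μ = 0` at the pair + one certificate (+ Schneider in rank one) -/

/-- **X9 ∧ Greenberg's `μ = 0` at the pair ∧ unit-coefficient certificate ∧ Schneider certificate
⇒ `BSD(E,p)`** (`r ≤ 1`): a one-line wrapper of the x9 seat's
`X9.bsdp_of_mu_eq_zero_of_analyticRank_le_one` (BCS 2025 Thm. 1.1.2 (a) `hBCSa`, Greenberg Thm. 4.1
`hGr`, period unit `hΩ`, Perrin-Riou–Schneider `hS`, Perrin-Riou 1987 `hPR`, modularity `hmodP` /
`hmod`, GZK `hGZK`), with the Schneider certificate in the `CornersSchneider` binder shape (asked at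
every rank, used in rank one). [cite: GreenbergLNM1716, §1 Conj. 1.11 and Thm. 4.1 (p. 102)]
[cite: BurungaleCastellaSkinner2025, Thm. 1.1.2 (a) (p. 2 of arXiv:2405.00270v2)] -/
theorem bsdp_of_classX9_of_greenbergMu_of_schneider
    (hBCSa : burungale_castella_skinner_charIdeal_eq_padicLFunction)
    (hGr : greenberg_charValue_rankZero) (hΩ : realPeriodRat_eq_unit_mul_plusPeriod)
    (hS : Schneider1985_order_charGenerator) (hPR : perrinRiou_rankOne_leadingTerms)
    (hmodP : nonempty_modularParametrizationData) (hmod : hasEntireLFunction_rat)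
    (hGZK : rank_eq_analyticRank_of_analyticRank_le_one)
    (hr : W.analyticRank ≤ 1) (hX9 : ClassX9 W p)
    (hμ : ∀ (κ : ZpExtension ℚ p) (γ : Field.absoluteGaloisGroup ℚ),
        κ.IsCyclotomic → κ.IsTopGenerator γ → IsCyclotomicVariable p γ →
      ∀ (D : W.SelmerDualData κ γ), D.mu = 0)
    (hcert : ∀ [NeZero (W.conductorNorm ℤ)] (f : CuspForm (CongruenceSubgroup.Gamma0 (W.conductorNorm ℤ)) 2),
        IsNewformOf W f → ∀ (ϖ : ℚ), (ϖ : ℝ) * W.realPeriodRat = plusPeriod f →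
      ∃ n : ℕ, ‖PowerSeries.coeff n
        (PowerSeries.C (ϖ : ℚ_[p]) * padicLFunction f (unitRoot W p : ℚ_[p]))‖ = 1)
    (hSch : ∀ Dh : PAdicHeightData W p, Dh.IsCanonical → SchneiderConjecture Dh) : BSDp W p :=
  X9.bsdp_of_mu_eq_zero_of_analyticRank_le_one W p hBCSa hGr hΩ hS hPR hmodP hmod hGZK hr hX9 hμ hcert
    (fun _ => hSch)

/-- **On X9 in analytic rank `0` the `μ = 0` hypothesis is NECESSARY** (given the same certificate):
re-export of the x9 seat's converse `X9.mu_eq_zero_of_bsdp` — so the reduction of the corner to the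
Keller–Yin locus below is TIGHT on X9 ∩ {r = 0}: there `BSD(E,p)` and Greenberg's Conj. 1.11 at the
pair are the SAME statement (`X9.bsdp_iff_mu_eq_zero`). [cite: GreenbergLNM1716, §1 Conj. 1.11]
[cite: CastellaEtAl2021, Thm. 5.1.4 and its proof (§5.1.3)] -/
theorem greenbergMu_of_bsdp_of_classX9_rankZero
    (hBCSa : burungale_castella_skinner_charIdeal_eq_padicLFunction)
    (hGr : greenberg_charValue_rankZero) (hΩ : realPeriodRat_eq_unit_mul_plusPeriod)
    (hmodP : nonempty_modularParametrizationData) (hmod : hasEntireLFunction_rat)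
    (hGZK : rank_eq_analyticRank_of_analyticRank_le_one)
    (hX9 : ClassX9 W p) (hr : W.analyticRank = 0) (hbsd : BSDp W p)
    (hcert : ∀ [NeZero (W.conductorNorm ℤ)] (f : CuspForm (CongruenceSubgroup.Gamma0 (W.conductorNorm ℤ)) 2),
        IsNewformOf W f → ∀ (ϖ : ℚ), (ϖ : ℝ) * W.realPeriodRat = plusPeriod f →
      ∃ n : ℕ, ‖PowerSeries.coeff n
        (PowerSeries.C (ϖ : ℚ_[p]) * padicLFunction f (unitRoot W p : ℚ_[p]))‖ = 1) :
    ∀ (κ : ZpExtension ℚ p) (γ : Field.absoluteGaloisGroup ℚ),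
        κ.IsCyclotomic → κ.IsTopGenerator γ → IsCyclotomicVariable p γ →
      ∀ (D : W.SelmerDualData κ γ), D.mu = 0 :=
  X9.mu_eq_zero_of_bsdp W p hBCSa hGr hΩ hmodP hmod hGZK hX9 hr hbsd hcert

/-! ### The §A headline at `p ≥ 5`: the corner is the Keller–Yin locus modulo Schneider and Greenberg-μ on X9 -/

/-- **SHARP MODULO THE SCHNEIDER CERTIFICATE AND GREENBERG'S `μ = 0` ON X9, non-CM: ELEVEN named
facts.** For every non-CM `E/ℚ` (globally minimal `W`) of analytic rank `≤ 1` and every good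
ORDINARY prime `p ≥ 5` such that (`hSch`) the canonical cyclotomic `p`-adic height on `E(ℚ)` is
non-degenerate, and — asked ONLY when `(E, p)` lies in X9 (image `5Ns/5S4/7Ns`) — (`hμ`) Greenberg's
`μ(X(E/ℚ_∞)) = 0` holds at the pair and (`hcert`) some coefficient of `𝓛_p(E)` is a `p`-adic unit,
`BSD(E,p)` holds unless `(E, p)` is Eisenstein-anomalous of TYPE A (`ClassX1 W p ∧ ¬ GVPar W p`, the
Keller–Yin locus: X1a in rank one, X1b-A in rank zero). Named facts: Burungale–Castella–Skinner 2025
Cor. 1.3.1 (`hBCS`, PUB\*) and Thm. 1.1.2 (a) (`hBCSa`, PUB), GZK (`hGZK`), Castella–Grossi–Skinner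
2025 Thm. D (`hCGS`), Greenberg–Vatsal 2000 Thm. (1.3) (`hGV`) with Greenberg 1999 Thm. 4.1 (`hGr`),
modularity (`hmod`, `hmodP`), Perrin-Riou–Schneider (`hS`), Perrin-Riou 1987 (`hPR`), the period
unit (`hΩ`). Outside X9: `CornersSchneider.bsdp_or_typeA_or_classX9_of_five_le_of_schneider`; on X9:
`bsdp_of_classX9_of_greenbergMu_of_schneider`. RESIDUAL-MAP §A / §I N1 + N3 in kernel form.
[folklore] -/
theorem bsdp_goodOrd_of_five_le_of_schneider_of_greenbergMu
    (hBCS : BurungaleCastellaSkinner2025.cor131_padicValRat_bsd_rank_le_one)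
    (hBCSa : burungale_castella_skinner_charIdeal_eq_padicLFunction)
    (hGZK : rank_eq_analyticRank_of_analyticRank_le_one)
    (hCGS : CastellaGrossiSkinner2025.thmD_padicValRat_bsd_rank_le_one)
    (hGV : GreenbergVatsal2000.thm13_charIdeal_eq_of_gvPar) (hGr : greenberg_charValue_rankZero)
    (hmod : hasEntireLFunction_rat) (hmodP : nonempty_modularParametrizationData)
    (hS : Schneider1985_order_charGenerator) (hPR : perrinRiou_rankOne_leadingTerms)
    (hΩ : realPeriodRat_eq_unit_mul_plusPeriod)
    (hcm : ¬ W.HasCM) (hr : W.analyticRank ≤ 1) (hgo : GoodOrd W p) (h5 : 5 ≤ p)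
    (hSch : ∀ Dh : PAdicHeightData W p, Dh.IsCanonical → SchneiderConjecture Dh)
    (hμ : ClassX9 W p → ∀ (κ : ZpExtension ℚ p) (γ : Field.absoluteGaloisGroup ℚ),
        κ.IsCyclotomic → κ.IsTopGenerator γ → IsCyclotomicVariable p γ →
      ∀ (D : W.SelmerDualData κ γ), D.mu = 0)
    (hcert : ClassX9 W p → ∀ [NeZero (W.conductorNorm ℤ)]
        (f : CuspForm (CongruenceSubgroup.Gamma0 (W.conductorNorm ℤ)) 2),
        IsNewformOf W f → ∀ (ϖ : ℚ), (ϖ : ℝ) * W.realPeriodRat = plusPeriod f →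
      ∃ n : ℕ, ‖PowerSeries.coeff n
        (PowerSeries.C (ϖ : ℚ_[p]) * padicLFunction f (unitRoot W p : ℚ_[p]))‖ = 1)
    (hA : ¬ (ClassX1 W p ∧ ¬ GVPar W p)) : BSDp W p := by
  rcases bsdp_or_typeA_or_classX9_of_five_le_of_schneider hBCS hGZK hCGS hGV hGr hmod hmodP hS hPR
      hcm hr hgo h5 hSch with h | hA' | hX9
  · exact h
  · exact absurd hA' hA
  · haveI : NeZero (W.conductorNorm ℤ) := ⟨(W.conductorNorm_pos_holds).ne'⟩
    exact bsdp_of_classX9_of_greenbergMu_of_schneider hBCSa hGr hΩ hS hPR hmodP hmod hGZK hr hX9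
      (hμ hX9) (fun f hf ϖ hϖ => hcert hX9 f hf ϖ hϖ) hSch

/-- **Partition form at `p ≥ 5` under the Schneider certificate and Greenberg-μ on X9 (non-CM, good
ordinary): `BSD(E,p) ∨ (X1 ∧ ¬gvpar)`** from the same eleven named facts — the good ordinary axis at
`p ≥ 5` ends in the Keller–Yin locus alone. [folklore] -/
theorem bsdp_or_typeA_of_five_le_of_schneider_of_greenbergMu
    (hBCS : BurungaleCastellaSkinner2025.cor131_padicValRat_bsd_rank_le_one)
    (hBCSa : burungale_castella_skinner_charIdeal_eq_padicLFunction)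
    (hGZK : rank_eq_analyticRank_of_analyticRank_le_one)
    (hCGS : CastellaGrossiSkinner2025.thmD_padicValRat_bsd_rank_le_one)
    (hGV : GreenbergVatsal2000.thm13_charIdeal_eq_of_gvPar) (hGr : greenberg_charValue_rankZero)
    (hmod : hasEntireLFunction_rat) (hmodP : nonempty_modularParametrizationData)
    (hS : Schneider1985_order_charGenerator) (hPR : perrinRiou_rankOne_leadingTerms)
    (hΩ : realPeriodRat_eq_unit_mul_plusPeriod)
    (hcm : ¬ W.HasCM) (hr : W.analyticRank ≤ 1) (hgo : GoodOrd W p) (h5 : 5 ≤ p)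
    (hSch : ∀ Dh : PAdicHeightData W p, Dh.IsCanonical → SchneiderConjecture Dh)
    (hμ : ClassX9 W p → ∀ (κ : ZpExtension ℚ p) (γ : Field.absoluteGaloisGroup ℚ),
        κ.IsCyclotomic → κ.IsTopGenerator γ → IsCyclotomicVariable p γ →
      ∀ (D : W.SelmerDualData κ γ), D.mu = 0)
    (hcert : ClassX9 W p → ∀ [NeZero (W.conductorNorm ℤ)]
        (f : CuspForm (CongruenceSubgroup.Gamma0 (W.conductorNorm ℤ)) 2),
        IsNewformOf W f → ∀ (ϖ : ℚ), (ϖ : ℝ) * W.realPeriodRat = plusPeriod f →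
      ∃ n : ℕ, ‖PowerSeries.coeff n
        (PowerSeries.C (ϖ : ℚ_[p]) * padicLFunction f (unitRoot W p : ℚ_[p]))‖ = 1) :
    BSDp W p ∨ (ClassX1 W p ∧ ¬ GVPar W p) := by
  by_cases hA : ClassX1 W p ∧ ¬ GVPar W p
  · exact Or.inr hA
  · exact Or.inl (bsdp_goodOrd_of_five_le_of_schneider_of_greenbergMu hBCS hBCSa hGZK hCGS hGV hGr hmod
      hmodP hS hPR hΩ hcm hr hgo h5 hSch hμ hcert hA)

/-- **EVERY `E/ℚ` (CM included): THIRTEEN named facts** — the eleven of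
`bsdp_goodOrd_of_five_le_of_schneider_of_greenbergMu` plus, on the CM branch (no corner at a good odd
prime, `Corners.bsdp_cm_of_good_or_mult_rankZero`), Rubin 1991 ∧ Burungale–Flach 2024 (`hCM`) and
Kobayashi 2013 Cor. 1.4 (`hKob`). [folklore] -/
theorem bsdp_goodOrd_of_five_le_allCurves_of_schneider_of_greenbergMu
    (hBCS : BurungaleCastellaSkinner2025.cor131_padicValRat_bsd_rank_le_one)
    (hBCSa : burungale_castella_skinner_charIdeal_eq_padicLFunction)
    (hGZK : rank_eq_analyticRank_of_analyticRank_le_one)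
    (hCGS : CastellaGrossiSkinner2025.thmD_padicValRat_bsd_rank_le_one)
    (hGV : GreenbergVatsal2000.thm13_charIdeal_eq_of_gvPar) (hGr : greenberg_charValue_rankZero)
    (hmod : hasEntireLFunction_rat) (hmodP : nonempty_modularParametrizationData)
    (hS : Schneider1985_order_charGenerator) (hPR : perrinRiou_rankOne_leadingTerms)
    (hΩ : realPeriodRat_eq_unit_mul_plusPeriod)
    (hCM : bsdTriple_of_hasCM_of_L_one_ne_zero) (hKob : Kobayashi2013.cor14_bsdp_of_cm_rank_one)
    (hr : W.analyticRank ≤ 1) (hgo : GoodOrd W p) (h5 : 5 ≤ p)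
    (hSch : ∀ Dh : PAdicHeightData W p, Dh.IsCanonical → SchneiderConjecture Dh)
    (hμ : ClassX9 W p → ∀ (κ : ZpExtension ℚ p) (γ : Field.absoluteGaloisGroup ℚ),
        κ.IsCyclotomic → κ.IsTopGenerator γ → IsCyclotomicVariable p γ →
      ∀ (D : W.SelmerDualData κ γ), D.mu = 0)
    (hcert : ClassX9 W p → ∀ [NeZero (W.conductorNorm ℤ)]
        (f : CuspForm (CongruenceSubgroup.Gamma0 (W.conductorNorm ℤ)) 2),
        IsNewformOf W f → ∀ (ϖ : ℚ), (ϖ : ℝ) * W.realPeriodRat = plusPeriod f →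
      ∃ n : ℕ, ‖PowerSeries.coeff n
        (PowerSeries.C (ϖ : ℚ_[p]) * padicLFunction f (unitRoot W p : ℚ_[p]))‖ = 1)
    (hA : ¬ (ClassX1 W p ∧ ¬ GVPar W p)) : BSDp W p := by
  by_cases hcm : W.HasCM
  · exact bsdp_cm_of_good_or_mult_rankZero hCM hKob hmod hr hcm (by omega) (Or.inl hgo.1)
  · exact bsdp_goodOrd_of_five_le_of_schneider_of_greenbergMu hBCS hBCSa hGZK hCGS hGV hGr hmod hmodP
      hS hPR hΩ hcm hr hgo h5 hSch hμ hcert hA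

/-! ### The coordinator's domain at `p ≥ 5` under the two per-pair hypotheses -/

/-- **Non-CM, `p ≥ 5`, 'good ORDINARY, or MULTIPLICATIVE with `r = 0`': TWELVE named facts**
(+ Skinner 2016 Thm. C `hSk`, row C1). Outside the corners `X1 ∧ ¬gvpar` (Keller–Yin locus, ordinary
axis), X11a ('(ram) fails') and X2 (`E[p]` reducible) (multiplicative axis), `BSD(E,p)` holds,
granted the pair's Schneider certificate and, on X9, Greenberg's `μ = 0` + the unit-coefficient
certificate. On the multiplicative axis all three per-pair binders are idle
(`Corners.bsdp_mult_rankZero_of_not_corner`). [folklore] -/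
theorem bsdp_goodOrd_or_mult_of_five_le_of_schneider_of_greenbergMu
    (hBCS : BurungaleCastellaSkinner2025.cor131_padicValRat_bsd_rank_le_one)
    (hBCSa : burungale_castella_skinner_charIdeal_eq_padicLFunction)
    (hGZK : rank_eq_analyticRank_of_analyticRank_le_one)
    (hCGS : CastellaGrossiSkinner2025.thmD_padicValRat_bsd_rank_le_one)
    (hGV : GreenbergVatsal2000.thm13_charIdeal_eq_of_gvPar) (hGr : greenberg_charValue_rankZero)
    (hmod : hasEntireLFunction_rat) (hmodP : nonempty_modularParametrizationData)
    (hS : Schneider1985_order_charGenerator) (hPR : perrinRiou_rankOne_leadingTerms)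
    (hΩ : realPeriodRat_eq_unit_mul_plusPeriod)
    (hSk : Skinner2016.thmC_padicValRat_bsd_rank_zero)
    (hcm : ¬ W.HasCM) (hr : W.analyticRank ≤ 1) (h5 : 5 ≤ p)
    (hdom : GoodOrd W p ∨ (Mult W p ∧ W.analyticRank = 0))
    (hSch : ∀ Dh : PAdicHeightData W p, Dh.IsCanonical → SchneiderConjecture Dh)
    (hμ : ClassX9 W p → ∀ (κ : ZpExtension ℚ p) (γ : Field.absoluteGaloisGroup ℚ),
        κ.IsCyclotomic → κ.IsTopGenerator γ → IsCyclotomicVariable p γ →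
      ∀ (D : W.SelmerDualData κ γ), D.mu = 0)
    (hcert : ClassX9 W p → ∀ [NeZero (W.conductorNorm ℤ)]
        (f : CuspForm (CongruenceSubgroup.Gamma0 (W.conductorNorm ℤ)) 2),
        IsNewformOf W f → ∀ (ϖ : ℚ), (ϖ : ℝ) * W.realPeriodRat = plusPeriod f →
      ∃ n : ℕ, ‖PowerSeries.coeff n
        (PowerSeries.C (ϖ : ℚ_[p]) * padicLFunction f (unitRoot W p : ℚ_[p]))‖ = 1)
    (hA : ¬ (ClassX1 W p ∧ ¬ GVPar W p)) (hX11a : ¬ ClassX11a W p) (hX2 : ¬ ClassX2 W p) :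
    BSDp W p := by
  rcases hdom with hgo | ⟨hm, hr0⟩
  · exact bsdp_goodOrd_of_five_le_of_schneider_of_greenbergMu hBCS hBCSa hGZK hCGS hGV hGr hmod hmodP
      hS hPR hΩ hcm hr hgo h5 hSch hμ hcert hA
  · exact bsdp_mult_rankZero_of_not_corner hSk hmod hGZK (by omega) hm hr0 hX11a hX2

end Curve

end Summit.BirchSwinnertonDyer.Rank1Residual
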